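import Summits.AnomalousDissipation.AnomalousDissipation.Theses.StirringSphere
import Summits.AnomalousDissipation.AnomalousDissipation.Theses.Ensemble
import Summits.AnomalousDissipation.AnomalousDissipation.Theorems.StirringSphereEnsembleRealizationAugmentedLiftOfCEI
import Summits.AnomalousDissipation.AnomalousDissipation.Theorems.StirringSphereEnsembleRealizationStubMarginalMeans
import Summits.AnomalousDissipation.AnomalousDissipation.Theorems.StirringSphereEnsembleRealizationStubPathwiseCoupling
import Summits.AnomalousDissipation.AnomalousDissipation.Theorems.MomentParityGalerkinEnsembleRealizationStubTimeAverages
import Summits.AnomalousDissipation.AnomalousDissipation.Theorems.MomentParityGalerkinEnsembleRealization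
import Literature.Dynamics.Ergodic.BirkhoffErgodicTheoremProofs

/-!
# Crux `EnsembleRealization` (stmt-AnomalousDissipation-0215) — line `augmented-lift`: the crux on the
# DISSIPATIVE Foias–Prodi class (PROVED) and the reduction `FP ⇒ CEI` ⟹ `EnsembleRealization`

Supports stmt-AnomalousDissipation-0215 (registered stub `stub_ensembleRealizationDiss`). Nothing here closes the
item: the crux quantifies over ALL Foias–Prodi measures, and `FP ⇒ CEI` (the line's stub `stub_cylEnergyIneq`: every
Foias–Prodi stationary statistical solution has no mean energy backscatter from infinite wavenumber conditionally on
cylindrical data, cf. `stub_cylEnergyIneqFluxLimit`) is OPEN. What is landed: (1) `stub_ensembleRealizationDiss` — the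
crux restricted to Foias–Prodi measures satisfying the cylindrically weighted energy inequalities `CEI` (every
time-average / Vishik–Fursikov / Galerkin-limit measure does), with `M = 16‖f‖₂²E²/ε² + 1`; (2) the one-line reductions
`ensembleRealization_of_cei` / `ensemble_ensembleRealization_of_cei` for the two byte-identical route decls.
-/

noncomputable section

-- every `Summit.AnomalousDissipation.AnomalousDissipation.…` name repeats the summit = sub-problem segment (D-0017 layout)
set_option linter.dupNamespace false

open MeasureTheory Set Filter Topology Function Metric UnitAddTorus
open scoped BigOperators ENNReal InnerProductSpace RealInnerProductSpace

namespace Summit.AnomalousDissipation.AnomalousDissipation.Theorems.EnsembleRealization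

open Literature.Analysis.FunctionSpaces Literature.Analysis.FunctionSpaces.Torus
open Literature.Analysis.FluidPDE Literature.Analysis.FluidPDE.Torus
open Summit.AnomalousDissipation.AnomalousDissipation.Theorems.MomentParity

/-- **A.e. Birkhoff–Chebyshev selection** (a.e. variant of the landed
`MomentParity.exists_mem_support_birkhoff_limits`: the coupling is assumed only along a.e. point,
with a point-dependent constant, and the selected point is taken inside a prescribed conull set
`G`). On a probability space with a measure-preserving map `θ`, two nonnegative integrable
observables with `∫ F_e ≤ E`, `∫ F_d ≥ D` and the a.e. pathwise coupling
`A_n F_d ≤ c₀/n + A √(A_n F_e)` admit a point of `G` where both Birkhoff averages converge, to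
limits `e ≤ M`, `d ≥ D'`, as soon as `D' + A E/√M < D`. -/
theorem exists_good_point_ae {X : Type*} [MeasurableSpace X] (Q : Measure X) [IsProbabilityMeasure Q]
    {θ : X → X} (hθ : MeasurePreserving θ Q Q) {Fe Fd : X → ℝ} (hFe : Integrable Fe Q)
    (hFd : Integrable Fd Q) (hFe0 : ∀ x, 0 ≤ Fe x) (hFd0 : ∀ x, 0 ≤ Fd x) {A E D D' M : ℝ}
    (hA : 0 ≤ A) (hEint : ∫ x, Fe x ∂Q ≤ E) (hDint : D ≤ ∫ x, Fd x ∂Q) (hM : 0 < M) (hD'0 : 0 ≤ D')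
    (hgap : D' + A * E / Real.sqrt M < D)
    (hcouple : ∀ᵐ x ∂Q, ∃ c₀ : ℝ, ∀ n : ℕ, 0 < n →
      birkhoffAverage ℝ θ Fd n x ≤ c₀ / n + A * Real.sqrt (birkhoffAverage ℝ θ Fe n x))
    {G : X → Prop} (hG : ∀ᵐ x ∂Q, G x) :
    ∃ x, G x ∧ ∃ e d : ℝ,
      Tendsto (fun n => birkhoffAverage ℝ θ Fe n x) atTop (𝓝 e) ∧
      Tendsto (fun n => birkhoffAverage ℝ θ Fd n x) atTop (𝓝 d) ∧ e ≤ M ∧ D' ≤ d := by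
  -- Birkhoff for the two observables
  obtain ⟨es, hes_int, -, hes_eq, hes_lim⟩ :=
    Literature.Dynamics.Ergodic.birkhoff_ergodic_theorem_holds Q θ hθ Fe hFe
  obtain ⟨ds, hds_int, -, hds_eq, hds_lim⟩ :=
    Literature.Dynamics.Ergodic.birkhoff_ergodic_theorem_holds Q θ hθ Fd hFd
  -- nonnegativity of the averages and of the limits
  have havg_nonneg : ∀ (F : X → ℝ), (∀ x, 0 ≤ F x) → ∀ n x, 0 ≤ birkhoffAverage ℝ θ F n x := by
    intro F hF n x
    rw [birkhoffAverage, birkhoffSum]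
    exact smul_nonneg (inv_nonneg.2 n.cast_nonneg) (Finset.sum_nonneg fun i _ => hF _)
  -- the coupling passes to the limit: `d* ≤ A √e*`
  have hcouple_lim : ∀ᵐ x ∂Q, ds x ≤ A * Real.sqrt (es x) ∧ 0 ≤ es x ∧ 0 ≤ ds x := by
    filter_upwards [hcouple, hes_lim, hds_lim] with x ⟨c₀, hx⟩ hxe hxd
    refine ⟨?_, ge_of_tendsto' hxe fun n => havg_nonneg Fe hFe0 n x,
      ge_of_tendsto' hxd fun n => havg_nonneg Fd hFd0 n x⟩
    have h1 : Tendsto (fun n : ℕ => c₀ / n + A * Real.sqrt (birkhoffAverage ℝ θ Fe n x)) atTop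
        (𝓝 (0 + A * Real.sqrt (es x))) :=
      (tendsto_const_div_atTop_nhds_zero_nat c₀).add ((hxe.sqrt).const_mul A)
    rw [zero_add] at h1
    exact le_of_tendsto_of_tendsto hxd h1 (eventually_atTop.2 ⟨1, fun n hn => hx n hn⟩)
  -- Chebyshev: if no good point existed, `d* ≤ D' + A e* / √M` a.e., contradicting `∫ d* ≥ D`
  by_contra hno
  push Not at hno
  have hbad : ∀ᵐ x ∂Q, ds x ≤ D' + A / Real.sqrt M * es x := by
    filter_upwards [hG, hes_lim, hds_lim, hcouple_lim] with x hx hxe hxd ⟨hc, he0, hd0⟩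
    have hAM : 0 ≤ A / Real.sqrt M * es x := mul_nonneg (div_nonneg hA (Real.sqrt_nonneg _)) he0
    by_cases hcase : es x ≤ M
    · have h := hno x hx (es x) (ds x) hxe hxd hcase
      linarith
    · push Not at hcase
      have hsqM : 0 < Real.sqrt M := Real.sqrt_pos.2 hM
      have h1 : Real.sqrt (es x) ≤ es x / Real.sqrt M := by
        rw [le_div_iff₀ hsqM, ← Real.sqrt_mul he0]
        calc Real.sqrt (es x * M) ≤ Real.sqrt (es x * es x) := Real.sqrt_le_sqrt (by nlinarith)
          _ = es x := Real.sqrt_mul_self he0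
      have h2 : A * Real.sqrt (es x) ≤ A / Real.sqrt M * es x := by
        calc A * Real.sqrt (es x) ≤ A * (es x / Real.sqrt M) := mul_le_mul_of_nonneg_left h1 hA
          _ = A / Real.sqrt M * es x := by ring
      have hD'M : ds x ≤ A / Real.sqrt M * es x := hc.trans h2
      linarith
  -- integrate
  have hint_bad : ∫ x, ds x ∂Q ≤ D' + A / Real.sqrt M * ∫ x, es x ∂Q := by
    have h := integral_mono_ae hds_int ((integrable_const D').add (hes_int.const_mul (A / Real.sqrt M))) hbad
    have h2 : ∫ x, (fun _ => D') x + (fun x => A / Real.sqrt M * es x) x ∂Q =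
        D' + A / Real.sqrt M * ∫ x, es x ∂Q := by
      rw [integral_add (integrable_const D') (hes_int.const_mul _), integral_const, integral_const_mul,
        probReal_univ, one_smul]
    exact h.trans h2.le
  have hAM0 : 0 ≤ A / Real.sqrt M := div_nonneg hA (Real.sqrt_nonneg _)
  have h3 : A / Real.sqrt M * ∫ x, es x ∂Q ≤ A * E / Real.sqrt M := by
    rw [hes_eq]
    calc A / Real.sqrt M * ∫ x, Fe x ∂Q ≤ A / Real.sqrt M * E := mul_le_mul_of_nonneg_left hEint hAM0
      _ = A * E / Real.sqrt M := by ring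
  rw [hds_eq] at hint_bad
  linarith

/-- **`EnsembleRealization` HOLDS ON THE DISSIPATIVE FOIAS–PRODI CLASS** (registered stub
`stub_ensembleRealizationDiss`; = the planners' restatement candidate `EnsembleRealizationDiss` of
`Cruxes/EnsembleRealization/Sketch_dissipative_fp_class.lean`, with its class predicate `CylEnergyIneq` written inline).
For a smooth solenoidal mean-zero force `f` and budgets `E`, `ε > 0`, with `M := 16‖f‖₂²E²/ε² + 1`: every Foias–Prodi
stationary statistical solution `μ` of NS_ν(f), `ν > 0`, that satisfies the cylindrically weighted energy inequalities
`CEI(ν, f, μ)` and has mean energy `≤ E` and mean dissipation `≥ ε` is shadowed by ONE global Leray–Hopf trajectory with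
`meanEnergy ≤ M` and `meanDissipation ≥ ε/2`. Proof: the energy-augmented lift (`stub_augmentedLiftOfCEI`), the two
observables under the marginal identity (`stub_marginalMeans`), the pathwise Doering–Foias coupling
(`stub_pathwiseCoupling`), the a.e. Birkhoff–Chebyshev selection (`exists_good_point_ae`, `MomentParity.chebyshev_gap`)
and the time averages of a realised path (`MomentParity.stub_timeAverages`). -/
theorem stub_ensembleRealizationDiss (f : UnitAddTorus (Fin 3) → EuclideanSpace ℝ (Fin 3)) (hs : IsSmooth f)
    (hdiv : IsDivFree f) (hz : HasZeroMean f) (E ε : ℝ) (hε : 0 < ε) :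
    ∃ M : ℝ, ∀ (ν : ℝ) (μ : Measure (Torus.energySpace (Fin 3))), 0 < ν →
      IsStationaryStatisticalSolution ν f μ →
      (∀ (m : ℕ) (g : Fin m → UnitAddTorus (Fin 3) → EuclideanSpace ℝ (Fin 3)),
      (∀ j, IsSmooth (g j)) → (∀ j, IsDivFree (g j)) → (∀ j, HasZeroMean (g j)) →
      ∀ ψ : EuclideanSpace ℝ (Fin m) × ℝ → ℝ, ContDiff ℝ 1 ψ →
        (∃ C : ℝ, ∀ z, |ψ z| ≤ C ∧ ‖fderiv ℝ ψ z‖ ≤ C) →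
        (∀ ξ : EuclideanSpace ℝ (Fin m), Monotone fun e : ℝ => ψ (ξ, e)) →
        Integrable (fun u : Torus.energySpace (Fin 3) =>
            fderiv ℝ ψ (WithLp.toLp 2 fun j => pairing u.1 (g j), ‖u‖ ^ 2) (0, 1) *
              (ν * (eGradNormSq (u.1 : UnitAddTorus (Fin 3) → EuclideanSpace ℝ (Fin 3))).toReal - pairing u.1 f)) μ ∧
        Integrable (fun u : Torus.energySpace (Fin 3) =>
            nsGeneratorPairing ν f u (fun x => ∑ j, fderiv ℝ ψ (WithLp.toLp 2 fun j => pairing u.1 (g j), ‖u‖ ^ 2)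
              (EuclideanSpace.single j 1, 0) • g j x)) μ ∧
        2 * ∫ u, fderiv ℝ ψ (WithLp.toLp 2 fun j => pairing u.1 (g j), ‖u‖ ^ 2) (0, 1) *
              (ν * (eGradNormSq (u.1 : UnitAddTorus (Fin 3) → EuclideanSpace ℝ (Fin 3))).toReal - pairing u.1 f) ∂μ ≤
          ∫ u, nsGeneratorPairing ν f u (fun x => ∑ j, fderiv ℝ ψ (WithLp.toLp 2 fun j => pairing u.1 (g j), ‖u‖ ^ 2)
              (EuclideanSpace.single j 1, 0) • g j x) ∂μ) →
      Integrable (fun u => ‖u‖ ^ 2) μ → ensembleEnergy μ ≤ E → ε ≤ ensembleDissipation ν μ →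
      ∃ (u₀ : UnitAddTorus (Fin 3) → EuclideanSpace ℝ (Fin 3)) (u : ℝ → UnitAddTorus (Fin 3) → EuclideanSpace ℝ (Fin 3)),
        IsGlobalLerayHopf ν (fun _ => f) u₀ u ∧ meanEnergy u ≤ M ∧ ε / 2 ≤ meanDissipation ν u := by
  -- the constants of the statement (chosen before `ν`, `μ`)
  set Af : ℝ := Real.sqrt (∫ x, ‖f x‖ ^ 2) with hAf
  set M : ℝ := 16 * Af ^ 2 * E ^ 2 / ε ^ 2 + 1 with hM
  have hAf0 : 0 ≤ Af := Real.sqrt_nonneg _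
  have hMpos : 0 < M := by positivity
  refine ⟨M, fun ν μ hν hμ hceiμ hint hE hεμ => ?_⟩
  haveI := hμ.prob
  -- the FMRT support ball and the trajectory space
  have hf2 : MemLp f 2 volume := hs.memLp 2
  set R : ℝ := ‖hf2.toLp f‖ / (4 * Real.pi ^ 2 * ν) with hR
  have hR0 : 0 ≤ R := div_nonneg (norm_nonneg _) (by positivity)
  have hRae : ∀ᵐ u ∂μ, ‖u‖ ≤ R := hμ.ae_norm_le hν hf2
  set L : (Fin 3 → ℤ) → ℝ := pathLip ν (∫ x, ‖f x‖) R with hL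
  -- (A) no mean backscatter for the Foias–Prodi measure, (B) the energy-augmented superposition lift
  obtain ⟨P, hPprob, hPθ, hPmarg, hPreal⟩ :=
    stub_augmentedLiftOfCEI hν hs hdiv hz hμ hceiμ hR0 hRae
  haveI := hPprob
  -- (2) the two observables under `P`
  obtain ⟨hPE, hPD⟩ := stub_marginalMeans hν hμ P hPmarg
  obtain ⟨K, hK⟩ := hPD (ε / 8) (by positivity)
  have hEint : ∫ ω, energyMean ω.1 ∂P ≤ E := hPE ▸ hE
  have hDint : ε - ε / 8 ≤ ∫ ω, dissMean ν K ω.1 ∂P := by linarith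
  -- integrability and signs of the observables on the compact trajectory space
  have hFe : Integrable (fun x : ↥(pathSpace R L : Set (Path (Fin 3))) => energyMean x.1) P := by
    refine Integrable.of_bound (measurable_energyMean R L).aestronglyMeasurable (R ^ 2)
      (ae_of_all _ fun ω => ?_)
    rw [Real.norm_eq_abs, abs_of_nonneg (energyMean_mem_Icc ω.2).1]
    exact (energyMean_mem_Icc ω.2).2
  have hFd : Integrable (fun x : ↥(pathSpace R L : Set (Path (Fin 3))) => dissMean ν K x.1) P := by
    haveI : CompactSpace ↥(pathSpace R L : Set (Path (Fin 3))) := compactSpace_pathSpace R L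
    exact (continuous_dissMean R L ν K).integrable_of_hasCompactSupport
      (HasCompactSupport.of_compactSpace _)
  have hFe0 : ∀ x : ↥(pathSpace R L : Set (Path (Fin 3))), 0 ≤ energyMean x.1 := fun x =>
    (energyMean_mem_Icc x.2).1
  have hFd0 : ∀ x : ↥(pathSpace R L : Set (Path (Fin 3))), 0 ≤ dissMean ν K x.1 := fun x =>
    (dissMean_mem_Icc hν.le K x.2).1
  have hθP : MeasurePreserving (pathShiftOn R L (pathShift_mapsTo R L)) P P :=
    ⟨(continuous_pathShiftOn R L).measurable, hPθ⟩
  have hgap : ε / 2 + Af * E / Real.sqrt M < ε - ε / 8 := chebyshev_gap hε le_rfl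
  -- (4) the pathwise coupling along realised paths
  have hcouple : ∀ᵐ ω ∂P, ∃ c₀ : ℝ, ∀ n : ℕ, 0 < n →
      birkhoffAverage ℝ (pathShiftOn R L (pathShift_mapsTo R L)) (fun x => dissMean ν K x.1) n ω ≤
        c₀ / n + Af * Real.sqrt
          (birkhoffAverage ℝ (pathShiftOn R L (pathShift_mapsTo R L)) (fun x => energyMean x.1) n ω) := by
    filter_upwards [hPreal] with ω ⟨s, hs0, u, hLH, hcoef⟩
    exact stub_pathwiseCoupling hν hs hz ω hs0 hLH hcoef K
  -- Birkhoff–Chebyshev selection inside the realisation set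
  obtain ⟨ω, ⟨s, hs0, u, hLH, hcoef⟩, e, d, he, hd, heM, hdD⟩ :=
    exists_good_point_ae P hθP hFe hFd hFe0 hFd0 hAf0 hEint hDint hMpos
      (by positivity : (0 : ℝ) ≤ ε / 2) hgap hcouple hPreal
  -- Birkhoff averages are integer-window means
  have he' : Tendsto (fun m : ℕ => (m : ℝ)⁻¹ * ∫ t in (0 : ℝ)..m, pathEnergyTot ω.1 t) atTop (𝓝 e) := by
    refine he.congr fun m => ?_
    rw [birkhoffAverage, birkhoffSum_energyMean, smul_eq_mul]
  have hd' : Tendsto (fun m : ℕ => (m : ℝ)⁻¹ * ∫ t in (0 : ℝ)..m, pathDiss ν K ω.1 t) atTop (𝓝 d) := by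
    refine hd.congr fun m => ?_
    rw [birkhoffAverage, birkhoffSum_dissMean, smul_eq_mul]
  -- the landed time-averages stub of the sibling line
  obtain ⟨hEu, hDu⟩ := stub_timeAverages hν hs hz ω.2 hs0 hLH hcoef K he' hd'
  exact ⟨u 0, u, hLH, hEu.trans heM, hdD.trans hDu⟩

/-- **`FP ⇒ CEI` suffices for the crux** (route StirringSphere's decl): if every Foias–Prodi stationary statistical
solution at a smooth solenoidal mean-zero force and `ν > 0` satisfies the cylindrically weighted energy inequalities
(the line's one open stub `stub_cylEnergyIneq`), then `EnsembleRealization` holds. Pure logic over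
`stub_ensembleRealizationDiss`. -/
theorem ensembleRealization_of_cei
    (hCEI : ∀ (ν : ℝ) (f : UnitAddTorus (Fin 3) → EuclideanSpace ℝ (Fin 3)) (μ : Measure (Torus.energySpace (Fin 3))),
      0 < ν → IsSmooth f → IsDivFree f → HasZeroMean f → IsStationaryStatisticalSolution ν f μ →
      (∀ (m : ℕ) (g : Fin m → UnitAddTorus (Fin 3) → EuclideanSpace ℝ (Fin 3)),
      (∀ j, IsSmooth (g j)) → (∀ j, IsDivFree (g j)) → (∀ j, HasZeroMean (g j)) →
      ∀ ψ : EuclideanSpace ℝ (Fin m) × ℝ → ℝ, ContDiff ℝ 1 ψ →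
        (∃ C : ℝ, ∀ z, |ψ z| ≤ C ∧ ‖fderiv ℝ ψ z‖ ≤ C) →
        (∀ ξ : EuclideanSpace ℝ (Fin m), Monotone fun e : ℝ => ψ (ξ, e)) →
        Integrable (fun u : Torus.energySpace (Fin 3) =>
            fderiv ℝ ψ (WithLp.toLp 2 fun j => pairing u.1 (g j), ‖u‖ ^ 2) (0, 1) *
              (ν * (eGradNormSq (u.1 : UnitAddTorus (Fin 3) → EuclideanSpace ℝ (Fin 3))).toReal - pairing u.1 f)) μ ∧
        Integrable (fun u : Torus.energySpace (Fin 3) =>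
            nsGeneratorPairing ν f u (fun x => ∑ j, fderiv ℝ ψ (WithLp.toLp 2 fun j => pairing u.1 (g j), ‖u‖ ^ 2)
              (EuclideanSpace.single j 1, 0) • g j x)) μ ∧
        2 * ∫ u, fderiv ℝ ψ (WithLp.toLp 2 fun j => pairing u.1 (g j), ‖u‖ ^ 2) (0, 1) *
              (ν * (eGradNormSq (u.1 : UnitAddTorus (Fin 3) → EuclideanSpace ℝ (Fin 3))).toReal - pairing u.1 f) ∂μ ≤
          ∫ u, nsGeneratorPairing ν f u (fun x => ∑ j, fderiv ℝ ψ (WithLp.toLp 2 fun j => pairing u.1 (g j), ‖u‖ ^ 2)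
              (EuclideanSpace.single j 1, 0) • g j x) ∂μ)) :
    Summit.AnomalousDissipation.AnomalousDissipation.Theses.StirringSphere.EnsembleRealization := by
  intro f hs hdiv hz E ε hε
  obtain ⟨M, hM⟩ := stub_ensembleRealizationDiss f hs hdiv hz E ε hε
  exact ⟨M, fun ν μ hν hμ hint hE hεμ => hM ν μ hν hμ (hCEI ν f μ hν hs hdiv hz hμ) hint hE hεμ⟩

/-- The same for route Ensemble's byte-identical decl (the shared item stmt-AnomalousDissipation-0215). -/
theorem ensemble_ensembleRealization_of_cei
    (hCEI : ∀ (ν : ℝ) (f : UnitAddTorus (Fin 3) → EuclideanSpace ℝ (Fin 3)) (μ : Measure (Torus.energySpace (Fin 3))),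
      0 < ν → IsSmooth f → IsDivFree f → HasZeroMean f → IsStationaryStatisticalSolution ν f μ →
      (∀ (m : ℕ) (g : Fin m → UnitAddTorus (Fin 3) → EuclideanSpace ℝ (Fin 3)),
      (∀ j, IsSmooth (g j)) → (∀ j, IsDivFree (g j)) → (∀ j, HasZeroMean (g j)) →
      ∀ ψ : EuclideanSpace ℝ (Fin m) × ℝ → ℝ, ContDiff ℝ 1 ψ →
        (∃ C : ℝ, ∀ z, |ψ z| ≤ C ∧ ‖fderiv ℝ ψ z‖ ≤ C) →
        (∀ ξ : EuclideanSpace ℝ (Fin m), Monotone fun e : ℝ => ψ (ξ, e)) →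
        Integrable (fun u : Torus.energySpace (Fin 3) =>
            fderiv ℝ ψ (WithLp.toLp 2 fun j => pairing u.1 (g j), ‖u‖ ^ 2) (0, 1) *
              (ν * (eGradNormSq (u.1 : UnitAddTorus (Fin 3) → EuclideanSpace ℝ (Fin 3))).toReal - pairing u.1 f)) μ ∧
        Integrable (fun u : Torus.energySpace (Fin 3) =>
            nsGeneratorPairing ν f u (fun x => ∑ j, fderiv ℝ ψ (WithLp.toLp 2 fun j => pairing u.1 (g j), ‖u‖ ^ 2)
              (EuclideanSpace.single j 1, 0) • g j x)) μ ∧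
        2 * ∫ u, fderiv ℝ ψ (WithLp.toLp 2 fun j => pairing u.1 (g j), ‖u‖ ^ 2) (0, 1) *
              (ν * (eGradNormSq (u.1 : UnitAddTorus (Fin 3) → EuclideanSpace ℝ (Fin 3))).toReal - pairing u.1 f) ∂μ ≤
          ∫ u, nsGeneratorPairing ν f u (fun x => ∑ j, fderiv ℝ ψ (WithLp.toLp 2 fun j => pairing u.1 (g j), ‖u‖ ^ 2)
              (EuclideanSpace.single j 1, 0) • g j x) ∂μ)) :
    Summit.AnomalousDissipation.AnomalousDissipation.Theses.Ensemble.EnsembleRealization :=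
  ensembleRealization_of_cei hCEI

end Summit.AnomalousDissipation.AnomalousDissipation.Theorems.EnsembleRealization
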